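import Summits.CriticalPhenomena.PercolationContinuityZ3.Theorems.SahiInfiniteVolumeCylinderEvents
import Summits.CriticalPhenomena.PercolationContinuityZ3.Theorems.SahiInfiniteVolumeContinuum
import Summits.CriticalPhenomena.PercolationContinuityZ3.Theorems.SahiLebesgueCubeMinFunctions

/-!
# Sahi positivity in infinite volume, VI (UNCONDITIONAL, every order): two free slots and `min`-type cumulations on
# the Hilbert cube `[0,1]^ι`, arbitrary product probability measures
# (cell `prim-sahi`, typer seat; `--supports stmt-CriticalPhenomena-4575`)

Companion of `SahiInfiniteVolumeCumulations.lean` (finite chains) and `SahiLebesgueCubeMinFunctions.lean` (finitely many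
continuous coordinates).  Setting: `μ∞ = Measure.infinitePi μ` for an ARBITRARY family `μ i` of Borel probability measures on
`[0,1]`, ANY index set `ι`.  The infinite-volume cumulations are the nonnegative functions all of whose upper level sets are
finite-dimensional products of coordinate up-sets `{x | ∀ j ∈ F, x_j ∈ U_j}` (`F` finite, `U_j` up-sets of `[0,1]`).

* **`msahiE_infinitePi_unitInterval_nonneg_prodUpperCylinders_offTwo`** (events level) — every `n`: `0 ≤ E_n(f_0,…,f_{n−1})`
  under `μ∞` when the slots `k ∈ J` (`|J| ≤ 2`) are measurable nonnegative increasing functions and the slots `k ∉ J` are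
  indicators `1_{∀ j ∈ F_k, x_j ∈ U_{kj}}`.  (Average the free slots outside `s ⊇ ⋃ F_k`, factor through the finite cube
  `↥s → I ≃ Fin |s| → I`, apply `SahiLebesgueCumulations.msahiE_pi_nonneg_prodUpperLevelSets_offTwo`, let `s ↑ ι`.)
* **`msahiE_infinitePi_unitInterval_nonneg_prodUpperLevelSets_offTwo`** (functions level) — the slots `k ∉ J` any
  nonnegative functions whose upper level sets (`t ≥ 0`) are such cylinders or empty (measure-level layer cake).

New mathematics; no conjecture enters; no definitions; axioms standard.
-/

namespace Summit.CriticalPhenomena.PercolationContinuityZ3.Theorems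

namespace SahiInfiniteVolume

open MeasureTheory Measure Filter Set Function Finset
open Literature.Combinatorics.Sahi2008 Literature.Probability.Percolation
open scoped Topology unitInterval

section UnitInterval

variable {ι : Type*} (μ : ι → Measure I) [hμ : ∀ i, IsProbabilityMeasure (μ i)]

omit hμ in
/-- A finite-dimensional product of coordinate up-sets of `[0,1]^ι` is measurable. [folklore] -/
theorem measurableSet_prodUpperCylinder (F : Finset ι) {U : ι → Set I} (hU : ∀ j, IsUpperSet (U j)) :
    MeasurableSet {x : ι → I | ∀ j ∈ F, x j ∈ U j} := by
  have e : {x : ι → I | ∀ j ∈ F, x j ∈ U j} = ⋂ j ∈ F, (fun x : ι → I => x j) ⁻¹' U j := by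
    ext x
    simp
  rw [e]
  exact Finset.measurableSet_biInter F fun j _ => measurable_pi_apply j (hU j).ordConnected.measurableSet

omit hμ in
/-- … is an up-set. [folklore] -/
theorem isUpperSet_prodUpperCylinder (F : Finset ι) {U : ι → Set I} (hU : ∀ j, IsUpperSet (U j)) :
    IsUpperSet {x : ι → I | ∀ j ∈ F, x j ∈ U j} := fun _ _ hle hx j hj => hU j (hle j) (hx j hj)

omit hμ in
/-- … and its indicator depends only on the coordinates in `F`. [folklore] -/
theorem dependsOn_indicator_prodUpperCylinder (F : Finset ι) (U : ι → Set I) :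
    DependsOn ({x : ι → I | ∀ j ∈ F, x j ∈ U j}.indicator (1 : (ι → I) → ℝ)) ↑F := by
  intro x x' h
  have hiff : x ∈ {x : ι → I | ∀ j ∈ F, x j ∈ U j} ↔ x' ∈ {x : ι → I | ∀ j ∈ F, x j ∈ U j} := by
    simp only [Set.mem_setOf_eq]
    exact forall₂_congr fun j hj => by rw [h j hj]
  by_cases hx : x ∈ {x : ι → I | ∀ j ∈ F, x j ∈ U j}
  · rw [Set.indicator_of_mem hx, Set.indicator_of_mem (hiff.1 hx), Pi.one_apply, Pi.one_apply]
  · rw [Set.indicator_of_notMem hx, Set.indicator_of_notMem (fun h' => hx (hiff.2 h'))]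

/-- **Two free slots and cylinder cumulations on the Hilbert cube, events level, every `n`.**  For ANY index set and
ANY Borel probability measures `μ i` on `[0,1]`: if the `f_k`, `k ∈ J` (`|J| ≤ 2`), are measurable nonnegative increasing
and the `f_k`, `k ∉ J`, are indicators of finite-dimensional products of coordinate up-sets
`{x | ∀ j ∈ F_k, x_j ∈ U_{kj}}`, then `0 ≤ E_n(f_0,…,f_{n−1})` under `μ∞ = infinitePi μ`.
[this work; cite: Sahi2008, Thm. 2; Blinovsky2013; LiebSahi2021, Lemmas 2.2, 2.3, 3.8; GrimmettPercolation1999, Thm. 2.4] -/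
theorem msahiE_infinitePi_unitInterval_nonneg_prodUpperCylinders_offTwo {n : ℕ} (J : Finset (Fin n))
    (hJ : J.card ≤ 2) (f : Fin n → (ι → I) → ℝ) (hfm : ∀ k, Measurable (f k)) (hf0 : ∀ k x, 0 ≤ f k x)
    (hmono : ∀ k, Monotone (f k)) (F : Fin n → Finset ι) (U : Fin n → ι → Set I)
    (hU : ∀ k j, IsUpperSet (U k j))
    (hcyl : ∀ k, k ∉ J → f k = {x : ι → I | ∀ j ∈ F k, x j ∈ U k j}.indicator 1) :
    0 ≤ msahiE (infinitePi μ) n f := by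
  classical
  -- uniform bound: the top configuration
  set C : ℝ := ∑ k, f k fun _ => 1 with hC_def
  have hfb : ∀ k x, ‖f k x‖ ≤ C := fun k x => by
    rw [Real.norm_eq_abs, abs_of_nonneg (hf0 k x)]
    exact (hmono k fun j => unitInterval.le_one (x j)).trans
      (Finset.single_le_sum (f := fun k => f k fun _ => 1) (fun k _ => hf0 k _) (Finset.mem_univ k))
  have hdepF : ∀ k, k ∉ J → DependsOn (f k) ↑(F k) := fun k hk => by
    rw [hcyl k hk]
    exact dependsOn_indicator_prodUpperCylinder (F k) (U k)
  refine msahiE_infinitePi_nonneg_of_avg_nonneg μ f hfm (C := C) hfb (Finset.univ.biUnion F) fun s hs => ?_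
  have hFs : ∀ k, F k ⊆ s := fun k => (Finset.subset_biUnion_of_mem F (Finset.mem_univ k)).trans hs
  -- the averaging operator and the averaged family
  set T : ((ι → I) → ℝ) → (ι → I) → ℝ := fun φ x => ∫ η, φ (s.piecewise x η) ∂infinitePi μ with hT_def
  have hTfix : ∀ k, k ∉ J → T (f k) = f k := fun k hk =>
    funext fun x => integral_piecewise_eq_self μ ((hdepF k hk).mono (Finset.coe_subset.2 (hFs k))) x
  change 0 ≤ msahiE (infinitePi μ) n (fun k => T (f k))
  have hTm : ∀ k, Measurable (T (f k)) := fun k => measurable_integral_piecewise μ (hfm k)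
  have hTdep : ∀ k, DependsOn (T (f k)) ↑s := fun k => dependsOn_integral_piecewise μ (f k)
  have hT0 : ∀ k x, 0 ≤ T (f k) x := fun k x => integral_nonneg fun η => hf0 k _
  have hTmono : ∀ k, Monotone (T (f k)) := fun k => monotone_integral_piecewise μ (hmono k) (hfm k) (hfb k)
  -- factor through the finite cube `↥s → I`
  set G : Fin n → (↥s → I) → ℝ := fun k y => T (f k) (updateFinset (fun _ => 1) s y) with hG_def
  have hfac : ∀ k x, T (f k) x = G k (s.restrict x) := fun k x => by
    simp only [hG_def]
    exact hTdep k fun i hi => by simp [updateFinset, Finset.mem_coe.1 hi]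
  have hGm : ∀ k, Measurable (G k) := fun k => (hTm k).comp measurable_updateFinset
  have hupd : Monotone (updateFinset (fun _ => (1 : I)) s : (↥s → I) → ι → I) := by
    intro y y' hy i
    by_cases hi : i ∈ s
    · simp only [updateFinset, dif_pos hi]; exact hy ⟨i, hi⟩
    · simp only [updateFinset, dif_neg hi]; exact le_rfl
  have hGmono : ∀ k, Monotone (G k) := fun k => (hTmono k).comp hupd
  have hG0 : ∀ k y, 0 ≤ G k y := fun k y => hT0 k _
  have hmom : ∀ S : Finset (Fin n), ∫ x, (∏ k ∈ S, fun x => T (f k) x) x ∂infinitePi μ =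
      ∫ y, (∏ k ∈ S, G k) y ∂Measure.pi (fun i : ↥s => μ i) := by
    intro S
    have e : (fun x => (∏ k ∈ S, fun x => T (f k) x) x) = fun x => (∏ k ∈ S, G k) (s.restrict x) := by
      funext x
      simp only [Finset.prod_apply, hfac]
    have hm : Measurable fun y : ↥s → I => (∏ k ∈ S, G k) y := by
      have e' : (fun y : ↥s → I => (∏ k ∈ S, G k) y) = fun y => ∏ k ∈ S, G k y :=
        funext fun y => Finset.prod_apply y S G
      rw [e']
      exact Finset.measurable_prod S fun k _ => hGm k
    rw [e, integral_restrict_infinitePi μ hm.aestronglyMeasurable]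
  rw [msahiE_congr_of_moments (infinitePi μ) (Measure.pi fun i : ↥s => μ i) (fun k => T (f k)) G hmom]
  -- reindex `↥s ≃ Fin |s|`
  set e : Fin s.card ≃ ↥s := s.equivFin.symm with he
  have hmp := measurePreserving_piCongrLeft (α := fun _ : ↥s => I) (fun i : ↥s => μ i) e
  rw [← msahiE_comp_measurePreserving hmp (MeasurableEquiv.piCongrLeft (fun _ : ↥s => I) e).measurableEmbedding
    n G]
  -- the reindexing map is increasing
  have hRmono : Monotone (MeasurableEquiv.piCongrLeft (fun _ : ↥s => I) e : (Fin s.card → I) → (↥s → I)) := by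
    intro z z' hzz' a
    obtain ⟨b, rfl⟩ := e.surjective a
    rw [MeasurableEquiv.coe_piCongrLeft, Equiv.piCongrLeft_apply_apply, Equiv.piCongrLeft_apply_apply]
    exact hzz' b
  -- the cylinder slots, read on `Fin |s| → I`, are indicators of products of coordinate up-sets
  have hcylG : ∀ k, k ∉ J → (G k ∘ (MeasurableEquiv.piCongrLeft (fun _ : ↥s => I) e)) =
      {z : Fin s.card → I | ∀ b, z b ∈ (if ((e b : ↥s) : ι) ∈ F k then U k (e b) else Set.univ)}.indicator 1 := by
    intro k hk
    funext z
    simp only [Function.comp_apply, hG_def]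
    rw [hTfix k hk]
    set w : ι → I := updateFinset (fun _ => 1) s (MeasurableEquiv.piCongrLeft (fun _ : ↥s => I) e z) with hw
    rw [hcyl k hk]
    have hwj : ∀ b : Fin s.card, w ((e b : ↥s) : ι) = z b := by
      intro b
      rw [hw]
      simp only [updateFinset, dif_pos (e b).2, Subtype.coe_eta]
      rw [MeasurableEquiv.coe_piCongrLeft, Equiv.piCongrLeft_apply_apply]
    have hiff : w ∈ {x : ι → I | ∀ j ∈ F k, x j ∈ U k j} ↔
        z ∈ {z : Fin s.card → I | ∀ b, z b ∈ (if ((e b : ↥s) : ι) ∈ F k then U k (e b) else Set.univ)} := by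
      simp only [Set.mem_setOf_eq]
      constructor
      · intro h b
        by_cases hb : ((e b : ↥s) : ι) ∈ F k
        · rw [if_pos hb, ← hwj b]
          exact h _ hb
        · rw [if_neg hb]
          exact Set.mem_univ _
      · intro h j hj
        obtain ⟨b, hb⟩ := e.surjective ⟨j, hFs k hj⟩
        have hbj : ((e b : ↥s) : ι) = j := by rw [hb]
        have h1 := h b
        rw [if_pos (hbj ▸ hj : ((e b : ↥s) : ι) ∈ F k), ← hwj b, hbj] at h1
        exact h1
    by_cases hwmem : w ∈ {x : ι → I | ∀ j ∈ F k, x j ∈ U k j}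
    · rw [Set.indicator_of_mem hwmem, Set.indicator_of_mem (hiff.1 hwmem), Pi.one_apply, Pi.one_apply]
    · rw [Set.indicator_of_notMem hwmem, Set.indicator_of_notMem (fun h => hwmem (hiff.2 h))]
  refine SahiLebesgueCumulations.msahiE_pi_nonneg_prodUpperLevelSets_offTwo (fun b : Fin s.card => μ (e b)) J hJ _
    (fun k z => hG0 k _) (fun k _ => (hGm k).comp (MeasurableEquiv.piCongrLeft (fun _ : ↥s => I) e).measurable)
    (fun k _ => (hGmono k).comp hRmono) fun k hk t ht => ?_
  change (∃ U' : Fin s.card → Set I, (∀ b, IsUpperSet (U' b)) ∧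
      {z | t < (G k ∘ (MeasurableEquiv.piCongrLeft (fun _ : ↥s => I) e)) z} = {z | ∀ b, z b ∈ U' b}) ∨
    {z | t < (G k ∘ (MeasurableEquiv.piCongrLeft (fun _ : ↥s => I) e)) z} = ∅
  rw [hcylG k hk]
  by_cases ht1 : t < 1
  · refine Or.inl ⟨fun b => if ((e b : ↥s) : ι) ∈ F k then U k (e b) else Set.univ, fun b => ?_, ?_⟩
    · dsimp only
      by_cases hb : ((e b : ↥s) : ι) ∈ F k
      · rw [if_pos hb]; exact hU k _
      · rw [if_neg hb]; exact isUpperSet_univ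
    · ext z
      simp only [Set.mem_setOf_eq]
      by_cases hz : z ∈ {z : Fin s.card → I | ∀ b, z b ∈ (if ((e b : ↥s) : ι) ∈ F k then U k (e b) else Set.univ)}
      · rw [Set.indicator_of_mem hz, Pi.one_apply]
        exact ⟨fun _ => hz, fun _ => ht1⟩
      · rw [Set.indicator_of_notMem hz]
        exact ⟨fun h => absurd h (not_lt.2 ht), fun h => absurd h hz⟩
  · refine Or.inr (Set.eq_empty_of_forall_notMem fun z hz => ht1 (lt_of_lt_of_le hz ?_))
    exact Set.indicator_le_self' (fun _ _ => zero_le_one) z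

omit hμ in
/-- **Functions whose upper level sets are cylinder products of coordinate up-sets (or empty) are increasing.** [folklore] -/
theorem monotone_of_prodUpperCylinderLevelSets {φ : (ι → I) → ℝ} (h0 : ∀ x, 0 ≤ φ x)
    (hlev : ∀ t : ℝ, 0 ≤ t → (∃ (F : Finset ι) (U : ι → Set I), (∀ j, IsUpperSet (U j)) ∧
      {x | t < φ x} = {x | ∀ j ∈ F, x j ∈ U j}) ∨ {x | t < φ x} = ∅) : Monotone φ := by
  intro x y hxy
  by_contra hlt
  push Not at hlt
  have hx : x ∈ ({z | φ y < φ z} : Set (ι → I)) := hlt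
  rcases hlev (φ y) (h0 y) with ⟨F, U, hU, hUeq⟩ | hempty
  · rw [hUeq] at hx
    have hy : y ∈ ({z | ∀ j ∈ F, z j ∈ U j} : Set (ι → I)) := isUpperSet_prodUpperCylinder F hU hxy hx
    rw [← hUeq, Set.mem_setOf_eq] at hy
    exact lt_irrefl _ hy
  · rw [hempty] at hx
    exact hx

/-- **Two free slots and cylinder `min`-type cumulations on the Hilbert cube, functions level, every `n`.**  For ANY index
set and ANY Borel probability measures on `[0,1]`: if the `f_k`, `k ∈ J` (`|J| ≤ 2`), are measurable nonnegative
increasing and every other `f_k` is nonnegative with all upper level sets `{f_k > t}` (`t ≥ 0`) finite-dimensional products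
of coordinate up-sets `{x | ∀ j ∈ F, x_j ∈ U_j}` or empty, then `0 ≤ E_n(f_0,…,f_{n−1})` under `μ∞`.
[this work; cite: Sahi2008, Thm. 2; Blinovsky2013; LiebSahi2021, Lemma 2.2] -/
theorem msahiE_infinitePi_unitInterval_nonneg_prodUpperLevelSets_offTwo {n : ℕ} (J : Finset (Fin n))
    (hJ : J.card ≤ 2) (f : Fin n → (ι → I) → ℝ) (hf0 : ∀ k x, 0 ≤ f k x) (hfm : ∀ k, k ∈ J → Measurable (f k))
    (hmono : ∀ k, k ∈ J → Monotone (f k))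
    (hlev : ∀ k, k ∉ J → ∀ t : ℝ, 0 ≤ t → (∃ (F : Finset ι) (U : ι → Set I), (∀ j, IsUpperSet (U j)) ∧
      {x | t < f k x} = {x | ∀ j ∈ F, x j ∈ U j}) ∨ {x | t < f k x} = ∅) :
    0 ≤ msahiE (infinitePi μ) n f := by
  classical
  have hmono' : ∀ k, Monotone (f k) := fun k => by
    by_cases hk : k ∈ J
    · exact hmono k hk
    · exact monotone_of_prodUpperCylinderLevelSets (hf0 k) (hlev k hk)
  have hbd : ∀ k x, f k x ≤ ∑ j, f j fun _ => 1 := fun k x =>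
    (hmono' k fun j => unitInterval.le_one (x j)).trans
      (Finset.single_le_sum (f := fun j => f j fun _ => 1) (fun j _ => hf0 j _) (Finset.mem_univ k))
  let 𝒮 : Fin n → Set (Set (ι → I)) := fun k =>
    if k ∈ J then {A | IsUpperSet A ∧ MeasurableSet A}
    else {A | ∃ (F : Finset ι) (U : ι → Set I), (∀ j, IsUpperSet (U j)) ∧ A = {x | ∀ j ∈ F, x j ∈ U j}}
  have h𝒮m : ∀ k, ∀ A ∈ 𝒮 k, MeasurableSet A := by
    intro k A hA
    by_cases hk : k ∈ J
    · simp only [𝒮, hk, if_true, Set.mem_setOf_eq] at hA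
      exact hA.2
    · simp only [𝒮, hk, if_false, Set.mem_setOf_eq] at hA
      obtain ⟨F, U, hU, rfl⟩ := hA
      exact measurableSet_prodUpperCylinder F hU
  have h𝒮up : ∀ k, ∀ A ∈ 𝒮 k, IsUpperSet A := by
    intro k A hA
    by_cases hk : k ∈ J
    · simp only [𝒮, hk, if_true, Set.mem_setOf_eq] at hA
      exact hA.1
    · simp only [𝒮, hk, if_false, Set.mem_setOf_eq] at hA
      obtain ⟨F, U, hU, rfl⟩ := hA
      exact isUpperSet_prodUpperCylinder F hU
  refine msahiE_nonneg_of_levelSets_slotwise (infinitePi μ) 𝒮 h𝒮m (fun A hA => ?_) f hf0 hbd fun k t ht => ?_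
  · have hex : ∀ k, ∃ (F : Finset ι) (U : ι → Set I), (∀ j, IsUpperSet (U j)) ∧
        (k ∉ J → A k = {x | ∀ j ∈ F, x j ∈ U j}) := by
      intro k
      by_cases hk : k ∈ J
      · exact ⟨∅, fun _ => Set.univ, fun _ => isUpperSet_univ, fun h => absurd hk h⟩
      · have h := hA k
        simp only [𝒮, hk, if_false, Set.mem_setOf_eq] at h
        obtain ⟨F, U, hU, h⟩ := h
        exact ⟨F, U, hU, fun _ => h⟩
    choose F U hU hFU using hex
    refine msahiE_infinitePi_unitInterval_nonneg_prodUpperCylinders_offTwo μ J hJ _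
      (fun k => measurable_const.indicator (h𝒮m k _ (hA k)))
      (fun k x => Set.indicator_nonneg (fun _ _ => zero_le_one) x)
      (fun k => monotone_indicator_one_of_isUpperSet (h𝒮up k _ (hA k))) F U hU fun k hk => ?_
    rw [hFU k hk]
  · by_cases hk : k ∈ J
    · refine Or.inl ?_
      simp only [𝒮, hk, if_true, Set.mem_setOf_eq]
      exact ⟨fun x y hle hx => lt_of_lt_of_le hx (hmono k hk hle), measurableSet_lt measurable_const (hfm k hk)⟩
    · rcases hlev k hk t ht with ⟨F, U, hU, h⟩ | h
      · refine Or.inl ?_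
        simp only [𝒮, hk, if_false, Set.mem_setOf_eq]
        exact ⟨F, U, hU, h⟩
      · exact Or.inr h

end UnitInterval

end SahiInfiniteVolume

end Summit.CriticalPhenomena.PercolationContinuityZ3.Theorems
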